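import Summits.QuantumFields.YangMills.Theorems.FemtoTransferGapSlab
import HarnessLib

/-!
# The two retired children of the valley split of K1 `NearFlatRatioLaw`, kept as plain definitions
# (route `FlatTubeReduction`; K1a = item stmt-QuantumFields-24921, K1b = item stmt-QuantumFields-25191, both closed·MOOT after K1 stmt-QuantumFields-24720
# closed·proved by `FlatTubeReduction.nearFlatRatioLaw_proof`; seat `ym-line-ftr-p1` g22; R2b1 RECORD rung — no summit statement is proved here)

Route render `f3821d4c` (2026-08-30T08:55Z) dropped the decls `Theses.FlatTubeReduction.PinnedTubeRatioLaw` (K1a) and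
`Theses.FlatTubeReduction.ValleyRelocalisation` (K1b, rev 2) from the route module (its «kept as plain definitions» fallback failed), while two
importer-free leaf modules under `Theorems/` still name them: the closed·proved glue `nearFlatSplitGlue_proof` (item stmt-QuantumFields-24924,
`Theorems/FlatTubeReductionNearFlatSplitGlue.lean`) and the bookkeeping `Theorems/FlatTubeReductionNearFlatRatioLawOfPinnedValley.lean`
(tribunal-ym J ADDENDUM-1, director-ym R557-ym (3)).  THIS FILE restores the two statements VERBATIM (bodies byte-identical to the retired route
decls, now in the `Theorems.FlatTubeReduction` namespace) so that those leaves elaborate again.  DEFINITIONS ONLY — no claim is made about either: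

* `PinnedTubeRatioLaw` (K1a): the near-flat Born–Oppenheimer ratio law for tube states that are ALSO pinned away from non-trivial Polyakov holonomy
  at scale `β^{-2/3+2κ}`, `κ ∈ (0, 1/3)`;
* `ValleyRelocalisation` (K1b, rev 2): the tube maximiser relocalises to such a pinned tube state at cost `C·(λ_b²/L)·λ₀·‖ψ‖²`.

Both are implied a fortiori by nothing in this file; the route's theorem of record is K1 itself (`nearFlatRatioLaw_proof`), which does not pass
through them.  HONEST FRAMING: fixed-lattice statements (every `L`, eventually in `β`); not uniform in `L`, not infinite volume, not a mass gap, not Clay.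
-/

set_option autoImplicit false

namespace Summit.QuantumFields.YangMills.Theorems.FlatTubeReduction

/-- **K1a `PinnedTubeRatioLaw`** (retired route decl of item stmt-QuantumFields-24921, verbatim): on every fixed `(ℤ/L)³` there are `θ ∈ (0,1)`,
`κ ∈ (0,1/3)`, `C`, `β₀` such that for `β ≥ β₀` every physical `ψ ⊥ Ω` (Ω the positive exact ground state) supported in the flat tube
`{S < β^{-θ}}` AND vanishing wherever some Polyakov holonomy has `2 − |Re tr P| > β^{-2/3+2κ}` obeys the Born–Oppenheimer ratio law
`⟨ψ,K_βψ⟩·μ₀(L³β) ≤ e^{Cλ_b²/L}·μ₁(L³β)·λ₀·‖ψ‖²`.  Definition only (route-posited statement of route `FlatTubeReduction`, NOT a literature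
fact; Born–Oppenheimer mechanism after Lüscher 1983 §3).  A THEOREM a fortiori from K1: `pinnedTubeRatioLaw_holds` in
`Theorems/FlatTubeReductionNearFlatRatioLawOfPinnedValley.lean`. -/
def PinnedTubeRatioLaw : Prop :=
  open Summit.QuantumFields.YangMills.Theorems.FemtoTransferGap in ∀ (L : ℕ) [NeZero L], ∃ θ κ C β0 : ℝ, 0 < θ ∧ θ < 1 ∧ 0 < κ ∧ κ < 1 / 3 ∧ ∀ β : ℝ, β0 ≤ β → ∀ (Ω ψ : Literature.MathematicalPhysics.QuantumFieldTheory.GaugeConfig 3 L SU2 → ℝ), IsPhys Ω → (∀ U, 0 < Ω U) → transferApply β Ω = topValue su2Rep L β • Ω → IsPhys ψ → l2 ψ Ω = 0 → (∀ U, β ^ (-θ) < Literature.MathematicalPhysics.QuantumFieldTheory.wilsonAction su2Rep U → ψ U = 0) → (∀ U, (∃ (x : Literature.MathematicalPhysics.QuantumFieldTheory.Site 3 L) (e : Literature.MathematicalPhysics.QuantumFieldTheory.Edge 3 1), β ^ (-(2 : ℝ) / 3 + 2 * κ) < 2 - |((su2Rep (polyakovSite x U e)).trace).re|) → ψ U =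 0) → qform su2Rep β ψ ψ * levelValue su2Rep 1 ((L : ℝ) ^ 3 * β) 0 ≤ Real.exp (C * bareLambda β ^ 2 / L) * levelValue su2Rep 1 ((L : ℝ) ^ 3 * β) 1 * topValue su2Rep L β * l2 ψ ψ

/-- **K1b `ValleyRelocalisation`** (retired route decl of item stmt-QuantumFields-25191 = rev 2 of stmt-QuantumFields-24922, verbatim): for every
fixed `(ℤ/L)³` and every `θ ∈ (0,1)`, `κ ∈ (0,1/3)` there are `C ≥ 0`, `β₀` such that for `β ≥ β₀` the maximiser `ψ` of the tube Rayleigh problem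
(physical, `⊥ Ω`, tube-supported, maximal among such) admits a physical, tube-supported, holonomy-PINNED `ψ' ⊥ Ω` with `‖ψ'‖ ≤ ‖ψ‖` and
`⟨ψ,K_βψ⟩ ≤ ⟨ψ',K_βψ'⟩ + C·(λ_b²/L)·λ₀·‖ψ‖²`.  Definition only (route-posited statement of route `FlatTubeReduction`, NOT a literature
fact; Agmon-type relocalisation along the toron valley after Lüscher 1983 §3); OPEN as stated (conditional discharges at `37/120 < κ < 1/3`:
`valleyRelocalisation_at_ledger` in `Theorems/FlatTubeReductionValleyRelocalisationOfGain.lean`), and no longer on any closing path. -/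
def ValleyRelocalisation : Prop :=
  open Summit.QuantumFields.YangMills.Theorems.FemtoTransferGap in ∀ (L : ℕ) [NeZero L] (θ κ : ℝ), 0 < θ → θ < 1 → 0 < κ → κ < 1 / 3 → ∃ C β0 : ℝ, 0 ≤ C ∧ ∀ β : ℝ, β0 ≤ β → ∀ (Ω ψ : Literature.MathematicalPhysics.QuantumFieldTheory.GaugeConfig 3 L SU2 → ℝ), IsPhys Ω → (∀ U, 0 < Ω U) → transferApply β Ω = topValue su2Rep L β • Ω → IsPhys ψ → l2 ψ Ω = 0 → (∀ U, β ^ (-θ) < Literature.MathematicalPhysics.QuantumFieldTheory.wilsonAction su2Rep U → ψ U = 0) → (∀ φ : Literature.MathematicalPhysics.QuantumFieldTheory.GaugeConfig 3 L SU2 → ℝ, IsPhys φ → l2 φ Ω = 0 → (∀ U, β ^ (-θ) < Literature.MathematicalPhysics.QuantumFieldTheory.wilsonAction su2Rep U → φ U = 0) → qform su2Rep β φ φ * l2 ψ ψ ≤ qform su2Rep β ψ ψ * l2 φ φ) → ∃ ψ' : Literature.MathematicalPhysics.QuantumFieldTheory.GaugeConfig 3 L SU2 → ℝ, IsPhys ψ'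 ∧ l2 ψ' Ω = 0 ∧ (∀ U, β ^ (-θ) < Literature.MathematicalPhysics.QuantumFieldTheory.wilsonAction su2Rep U → ψ' U = 0) ∧ (∀ U, (∃ (x : Literature.MathematicalPhysics.QuantumFieldTheory.Site 3 L) (e : Literature.MathematicalPhysics.QuantumFieldTheory.Edge 3 1), β ^ (-(2 : ℝ) / 3 + 2 * κ) < 2 - |((su2Rep (polyakovSite x U e)).trace).re|) → ψ' U = 0) ∧ l2 ψ' ψ' ≤ l2 ψ ψ ∧ qform su2Rep β ψ ψ ≤ qform su2Rep β ψ' ψ' + C * bareLambda β ^ 2 / L * topValue su2Rep L β * l2 ψ ψ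

end Summit.QuantumFields.YangMills.Theorems.FlatTubeReduction
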